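import Mathlib
import Summits.KontsevichZagierPeriods.Zeta5Search.AperyOffDigitBinomials

/-!
# BlockRatioBinomial — the BLOCK-RATIO LEMMA `C(Np+b, Mp+d) ∈ C(N,M)·C(b,d)·(1 + pℤ_p)` (`0 ≤ d ≤ b < p`)
(cell zeta5-irr)

HONEST FRAMING: systematic search; no irrationality claim unless certified. INSTRUMENT lemma of the ζ(5)
census cell zeta5-irr (HOME `run/shared/lean/pub/zeta5-irr/`; zi-p2 THEOREM 6 (E⁺) «BLOCK-RATIO LEMMA
C(Np+b, Mp+d) ∈ C(N,M)·C(b,d)·(1+pℤ_p) for 0 ≤ d ≤ b ≤ p−1, N ≥ M — replaces Lucas when p | C(n₁+j₁,j₁)»,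
`zi-p2/probes/B8/thm6/THEOREM6.md`, graded PASS by zi-ref R6.6; reused in the THEOREM 7 blueprint L7.4/L7.5).
Nothing here is about ζ(5); no irrationality content; filing moves no rung. Filed by the engine seat zi-eng (g7) on
top of zi-eng g6's `OffDigitBinomials` machinery (`blockW`, `factorial_mul_eq_blockW`, the unit parts).

## The statement

Writing `N = M + e`, `b = d + f` (so no natural subtraction occurs), for every `p ≥ 1` the EXACT identity
**`C((M+e)p + (d+f), Mp + d) · W_M · W_e · ∏_{t=1}^{d}(Mp+t) · ∏_{t=1}^{f}(ep+t) = C(M+e, M) · W_{M+e} · ∏_{t=1}^{d+f}((M+e)p+t)`**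
(`choose_block_mul_eq`; `W_m = ∏_{p∤ℓ≤mp} ℓ`, from `(Xp + y)! = p^X X! W_X ∏_{t≤y}(Xp+t)`). For a prime `p` and
`d + f < p` all cofactors are prime to `p`, so **`v_p(C(Np+b, Mp+d)) = v_p(C(N,M))`** (`padicValNat_choose_block`),
and modulo `p` (`W_m ≡ (−1)^m`, `∏_{t≤y}(Xp+t) ≡ y!`) the UNIT PARTS satisfy Lucas:
**`[C(Np+b,Mp+d)/p^v]·d!·f! ≡ [C(N,M)/p^v]·(d+f)! (mod p)`**, `v = v_p(C(N,M))` (`cast_choose_block_div_mul`), i.e.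
`C(Np+b, Mp+d)/p^v ≡ (C(N,M)/p^v)·C(b,d) (mod p)` (`cast_choose_block_div`) — together: `C(Np+b,Mp+d) =
C(N,M)·C(b,d)·u` with `u ≡ 1 (mod p)` whenever `p ∤ C(b,d)` (automatic for `b < p`).
-/

namespace Summit.KontsevichZagierPeriods.Zeta5Search.BlockRatioBinomial

open Finset Nat
open Summit.KontsevichZagierPeriods.Zeta5Search.OffDigitBinomials (blockW factorial_mul_eq_blockW blockW_ne_zero
  factorial_add_eq_mul_prod coprime_blockW coprime_prod_mul_add cast_blockW cast_prod_mul_add)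

variable {p : ℕ}

/-- **Block-ratio identity, exact form**: for `p ≥ 1` and all `M e d f`,
`C((M+e)p + (d+f), Mp + d) · W_M · W_e · ∏_{t=1}^{d}(Mp+t) · ∏_{t=1}^{f}(ep+t) = C(M+e, M) · W_{M+e} · ∏_{t=1}^{d+f}((M+e)p+t)`. -/
theorem choose_block_mul_eq (hp : 0 < p) (M e d f : ℕ) :
    ((M + e) * p + (d + f)).choose (M * p + d) *
        (blockW p M * blockW p e * (∏ t ∈ Icc 1 d, (M * p + t)) * ∏ t ∈ Icc 1 f, (e * p + t)) =
      (M + e).choose M * (blockW p (M + e) * ∏ t ∈ Icc 1 (d + f), ((M + e) * p + t)) := by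
  have hK : M * p + d ≤ (M + e) * p + (d + f) := by nlinarith
  have hsub : (M + e) * p + (d + f) - (M * p + d) = e * p + f := by
    rw [show (M + e) * p + (d + f) = (M * p + d) + (e * p + f) by ring, Nat.add_sub_cancel_left]
  have h0 := Nat.choose_mul_factorial_mul_factorial hK
  rw [hsub, factorial_add_eq_mul_prod (M * p) d, factorial_add_eq_mul_prod (e * p) f,
    factorial_add_eq_mul_prod ((M + e) * p) (d + f), factorial_mul_eq_blockW hp M, factorial_mul_eq_blockW hp e,
    factorial_mul_eq_blockW hp (M + e)] at h0
  have h3 := Nat.choose_mul_factorial_mul_factorial (Nat.le_add_right M e)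
  rw [Nat.add_sub_cancel_left] at h3
  have hpow : p ^ (M + e) = p ^ M * p ^ e := pow_add _ _ _
  have hne : 0 < p ^ (M + e) * M ! * e ! := by positivity
  apply Nat.eq_of_mul_eq_mul_right hne
  calc ((M + e) * p + (d + f)).choose (M * p + d) *
          (blockW p M * blockW p e * (∏ t ∈ Icc 1 d, (M * p + t)) * ∏ t ∈ Icc 1 f, (e * p + t)) *
        (p ^ (M + e) * M ! * e !)
      = ((M + e) * p + (d + f)).choose (M * p + d) * (p ^ M * M ! * blockW p M * ∏ t ∈ Icc 1 d, (M * p + t)) *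
          (p ^ e * e ! * blockW p e * ∏ t ∈ Icc 1 f, (e * p + t)) := by rw [hpow]; ring
    _ = p ^ (M + e) * (M + e)! * blockW p (M + e) * ∏ t ∈ Icc 1 (d + f), ((M + e) * p + t) := by rw [h0]
    _ = p ^ (M + e) * ((M + e).choose M * M ! * e !) * blockW p (M + e) * ∏ t ∈ Icc 1 (d + f), ((M + e) * p + t) := by
          rw [h3]
    _ = (M + e).choose M * (blockW p (M + e) * ∏ t ∈ Icc 1 (d + f), ((M + e) * p + t)) *
          (p ^ (M + e) * M ! * e !) := by ring

/-- **Block-ratio lemma, valuation part**: for a prime `p` and `d + f < p`,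
`v_p(C((M+e)p + (d+f), Mp + d)) = v_p(C(M+e, M))` (no carry in the last digit: the last digit costs nothing). -/
theorem padicValNat_choose_block (hp : p.Prime) (M e : ℕ) {d f : ℕ} (hdf : d + f < p) :
    padicValNat p (((M + e) * p + (d + f)).choose (M * p + d)) = padicValNat p ((M + e).choose M) := by
  haveI := Fact.mk hp
  have h := congrArg (padicValNat p) (choose_block_mul_eq hp.pos M e d f)
  have hC : ((M + e) * p + (d + f)).choose (M * p + d) ≠ 0 := (Nat.choose_pos (by nlinarith)).ne'
  have hC' : (M + e).choose M ≠ 0 := (Nat.choose_pos (Nat.le_add_right M e)).ne'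
  have hW := blockW_ne_zero p
  have hPd : ∏ t ∈ Icc 1 d, (M * p + t) ≠ 0 := Finset.prod_ne_zero_iff.2 fun t ht ↦ by rw [mem_Icc] at ht; omega
  have hPf : ∏ t ∈ Icc 1 f, (e * p + t) ≠ 0 := Finset.prod_ne_zero_iff.2 fun t ht ↦ by rw [mem_Icc] at ht; omega
  have hPb : ∏ t ∈ Icc 1 (d + f), ((M + e) * p + t) ≠ 0 :=
    Finset.prod_ne_zero_iff.2 fun t ht ↦ by rw [mem_Icc] at ht; omega
  have v0 : ∀ {x : ℕ}, Nat.Coprime p x → padicValNat p x = 0 := fun hx ↦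
    padicValNat.eq_zero_of_not_dvd ((Nat.Prime.coprime_iff_not_dvd hp).1 hx)
  rw [padicValNat.mul hC (mul_ne_zero (mul_ne_zero (mul_ne_zero (hW M) (hW e)) hPd) hPf),
    padicValNat.mul (mul_ne_zero (mul_ne_zero (hW M) (hW e)) hPd) hPf, padicValNat.mul (mul_ne_zero (hW M) (hW e)) hPd,
    padicValNat.mul (hW M) (hW e), v0 (coprime_blockW hp M), v0 (coprime_blockW hp e),
    v0 (coprime_prod_mul_add hp M (by omega : d < p)), v0 (coprime_prod_mul_add hp e (by omega : f < p)),
    padicValNat.mul hC' (mul_ne_zero (hW (M + e)) hPb), padicValNat.mul (hW (M + e)) hPb,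
    v0 (coprime_blockW hp (M + e)), v0 (coprime_prod_mul_add hp (M + e) hdf)] at h
  omega

/-- **Block-ratio lemma, unit part**: for a prime `p` and `d + f < p`, writing `C((M+e)p+(d+f), Mp+d) = p^v·c` and
`C(M+e, M) = p^v·y` with `p ∤ c`, `p ∤ y` (`v = v_p(C(M+e,M))`, `padicValNat_choose_block`):
`c · d! · f! ≡ y · (d+f)! (mod p)`. -/
theorem cast_choose_block_div_mul (hp : p.Prime) (M e : ℕ) {d f : ℕ} (hdf : d + f < p) :
    (((((M + e) * p + (d + f)).choose (M * p + d) / p ^ padicValNat p (((M + e) * p + (d + f)).choose (M * p + d)) : ℕ)) :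
        ZMod p) * ((d ! : ℕ) : ZMod p) * ((f ! : ℕ) : ZMod p) =
      ((((M + e).choose M / p ^ padicValNat p ((M + e).choose M) : ℕ)) : ZMod p) * (((d + f)! : ℕ) : ZMod p) := by
  haveI := Fact.mk hp
  set C := ((M + e) * p + (d + f)).choose (M * p + d) with hC
  set Y := (M + e).choose M with hY
  set v := padicValNat p Y with hv
  have hvC : padicValNat p C = v := padicValNat_choose_block hp M e hdf
  obtain ⟨c, hc⟩ : p ^ v ∣ C := by rw [← hvC]; exact pow_padicValNat_dvd
  obtain ⟨y, hy⟩ : p ^ v ∣ Y := pow_padicValNat_dvd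
  have hpv : 0 < p ^ v := pow_pos hp.pos v
  have hcdiv : C / p ^ padicValNat p C = c := by rw [hvC, hc, Nat.mul_div_cancel_left _ hpv]
  have hydiv : Y / p ^ padicValNat p Y = y := by rw [← hv, hy, Nat.mul_div_cancel_left _ hpv]
  rw [hcdiv, hydiv]
  -- the exact identity divided by `p^v`
  have key := choose_block_mul_eq hp.pos M e d f
  rw [← hC, hc, ← hY, hy] at key
  have key' : c * (blockW p M * blockW p e * (∏ t ∈ Icc 1 d, (M * p + t)) * ∏ t ∈ Icc 1 f, (e * p + t)) =
      y * (blockW p (M + e) * ∏ t ∈ Icc 1 (d + f), ((M + e) * p + t)) := by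
    apply Nat.eq_of_mul_eq_mul_left hpv
    calc p ^ v * (c * (blockW p M * blockW p e * (∏ t ∈ Icc 1 d, (M * p + t)) * ∏ t ∈ Icc 1 f, (e * p + t)))
        = p ^ v * c * (blockW p M * blockW p e * (∏ t ∈ Icc 1 d, (M * p + t)) * ∏ t ∈ Icc 1 f, (e * p + t)) := by
          ring
      _ = p ^ v * y * (blockW p (M + e) * ∏ t ∈ Icc 1 (d + f), ((M + e) * p + t)) := key
      _ = p ^ v * (y * (blockW p (M + e) * ∏ t ∈ Icc 1 (d + f), ((M + e) * p + t))) := by ring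
  -- reduce modulo `p`
  have hz := congrArg (Nat.cast (R := ZMod p)) key'
  simp only [Nat.cast_mul] at hz
  rw [cast_blockW hp M, cast_blockW hp e, cast_blockW hp (M + e), cast_prod_mul_add p M d, cast_prod_mul_add p e f,
    cast_prod_mul_add p (M + e) (d + f), pow_add] at hz
  -- cancel the unit `(−1)^M (−1)^e`
  have hunit : ((-1 : ZMod p)) ^ M * (-1) ^ e ≠ 0 :=
    mul_ne_zero (pow_ne_zero _ (neg_ne_zero.2 one_ne_zero)) (pow_ne_zero _ (neg_ne_zero.2 one_ne_zero))
  apply mul_left_cancel₀ hunit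
  linear_combination hz

/-- **Block-ratio lemma, Lucas form for the unit parts**: for a prime `p`, `d + f < p`, with `c`, `y` as above:
`c ≡ y · C(d+f, d) (mod p)` — i.e. `C(Np+b, Mp+d) = C(N,M)·C(b,d)·u`, `u` a `p`-adic unit `≡ 1 (mod p)` when
`p ∤ C(b,d)` (zi-p2 THEOREM 6 (E⁺) BLOCK-RATIO LEMMA). -/
theorem cast_choose_block_div (hp : p.Prime) (M e : ℕ) {d f : ℕ} (hdf : d + f < p) :
    (((((M + e) * p + (d + f)).choose (M * p + d) / p ^ padicValNat p (((M + e) * p + (d + f)).choose (M * p + d)) : ℕ)) :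
        ZMod p) =
      ((((M + e).choose M / p ^ padicValNat p ((M + e).choose M) : ℕ)) : ZMod p) * (((d + f).choose d : ℕ) : ZMod p) := by
  haveI := Fact.mk hp
  have h := cast_choose_block_div_mul hp M e hdf
  have hb := congrArg (Nat.cast (R := ZMod p)) (Nat.choose_mul_factorial_mul_factorial (Nat.le_add_right d f))
  rw [Nat.add_sub_cancel_left] at hb
  push_cast at hb
  have hunit : ((d ! : ℕ) : ZMod p) * ((f ! : ℕ) : ZMod p) ≠ 0 := by
    refine mul_ne_zero ?_ ?_ <;> rw [Ne, ZMod.natCast_eq_zero_iff, hp.dvd_factorial] <;> omega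
  apply mul_right_cancel₀ hunit
  linear_combination h - ((((M + e).choose M / p ^ padicValNat p ((M + e).choose M) : ℕ)) : ZMod p) * hb

/-- Sanity instance (`p = 5`, `N = 2`, `M = 1`, `b = 3`, `d = 1`, i.e. `M = e = 1`, `d = 1`, `f = 2`):
`C(13, 6) = 1716 = C(2,1)·C(3,1)·286`, `286 ≡ 1 (mod 5)`; valuations `v_5(1716) = 0 = v_5(2)`. -/
example : padicValNat 5 (((1 + 1) * 5 + (1 + 2)).choose (1 * 5 + 1)) = padicValNat 5 ((1 + 1).choose 1) :=
  padicValNat_choose_block (by norm_num) 1 1 (by norm_num)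

end Summit.KontsevichZagierPeriods.Zeta5Search.BlockRatioBinomial
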